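import Mathlib
import Summits.PneNP.PneNP.Theorems.OverlapGapAlgebraSearchHardWindowTwoRoundLocal

/-!
# PneNP / OverlapGapAlgebra — `SearchHardWindow` / `SolvableImpliesStableSection`:
# RADIUS-`r` LOCAL RULES are ℓ²-stable (1/2) — light cones and the typically-Lipschitz bound

Support for cruxes `stmt-PneNP-2460` and `stmt-PneNP-2463`. Generalises the TWO-ROUND local class of
`…SearchHardWindowTwoRoundLocal{,Rung}` to every constant radius `r`, definition-free: a search
map `g` is a RADIUS-`r` LOCAL RULE (hypothesis `hloc`) if its output bit at `v` is an arbitrary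
(label-dependent) function of the labelled clauses that `v` SEES WITHIN RADIUS `r` — clause `i` is
seen by `v` iff some variable of `i` is joined to `v` by a co-occurrence walk of length `r`
(`p : ℕ → Fin n`, `p 0 = v`, `p r ∈ vars i`, consecutive entries equal or co-occurring in a
clause; stuttering makes the balls increasing in `r`). Radius `0` = the clauses containing `v`
(one round of message passing), radius `1` = the two-round class; radius `r` contains every
`r`-round message-passing rule (Belief / Survey / Warning Propagation run for `r` rounds and
rounded locally, `r` rounds of parallel local repair, Unit-Clause-style local guesses of depth
`r`) — the "local algorithms" of Bresler–Huang (arXiv:2106.02129, Cor. 2.13 for the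
factor-graph-local class, here with labels and arbitrary dependence on them).

* `shwRad_card_cooccur_le` — at most `k·deg(u)` variables co-occur with `u`;
* `shwRad_card_ball_le` — light cones: at most `(kD + 1)^t` variables are joined to `w` by a walk
  of length `t` (`D` = maximum clause-degree); `shwRad_card_sees_le` — at most `k (kD+1)^r`
  variables see a given clause within radius `r`;
* `shwRad_hamming_le`, `shwRad_hamming_update_le` — under `hloc` a single-literal change moves the
  output by at most `2k (kD + k + 1)^r`: radius-`r` rules are TYPICALLY LIPSCHITZ with
  `s(n) = 2k (3k log n + k + 1)^r` at instances of maximum clause-degree `≤ 3 log n`;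
* `shwRad_meanSquare` — hence ℓ²-stable with `s₂(n) = s(n)² + 1` (bridge
  `shwLoc_meanSquare_of_typLipschitz`).
The rung with a rate, the transfer and the crux-language corollary: `…RadiusLocalRung`.
No definitions; axioms `propext`, `Classical.choice`, `Quot.sound`.
-/

set_option linter.dupNamespace false -- `Summit.PneNP.PneNP.…`: summit = sub-problem (D-0017)

namespace Summit.PneNP.PneNP.Theorems

open Finset Filter
open scoped Classical

section RadiusLocal

variable {m k n : ℕ}

/-- At most `k · deg(u)` variables co-occur with `u` (share a clause with it). -/
theorem shwRad_card_cooccur_le (Φ : Fin m → Fin k → Fin n × Bool) (u : Fin n) :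
    ((univ : Finset (Fin n)).filter fun v =>
        ∃ i : Fin m, ∃ j j' : Fin k, (Φ i j).1 = v ∧ (Φ i j').1 = u).card ≤
      k * ((univ : Finset (Fin m)).filter fun i => ∃ j, (Φ i j).1 = u).card := by
  have hsub : ((univ : Finset (Fin n)).filter fun v =>
        ∃ i : Fin m, ∃ j j' : Fin k, (Φ i j).1 = v ∧ (Φ i j').1 = u) ⊆
      ((univ : Finset (Fin m)).filter fun i => ∃ j, (Φ i j).1 = u).biUnion
        fun i => (univ : Finset (Fin k)).image fun j => (Φ i j).1 := by
    intro v hv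
    simp only [mem_filter, mem_univ, true_and] at hv
    obtain ⟨i, j, j', hj, hj'⟩ := hv
    rw [Finset.mem_biUnion]
    refine ⟨i, ?_, ?_⟩
    · simp only [mem_filter, mem_univ, true_and]
      exact ⟨j', hj'⟩
    · rw [Finset.mem_image]
      exact ⟨j, mem_univ _, hj⟩
  refine (card_le_card hsub).trans (card_biUnion_le.trans ?_)
  calc ∑ i ∈ (univ : Finset (Fin m)).filter (fun i => ∃ j, (Φ i j).1 = u),
        ((univ : Finset (Fin k)).image fun j => (Φ i j).1).card
      ≤ ∑ _i ∈ (univ : Finset (Fin m)).filter (fun i => ∃ j, (Φ i j).1 = u), k :=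
        sum_le_sum fun i _ => card_image_le.trans (by rw [card_univ, Fintype.card_fin])
    _ = _ := by rw [sum_const, smul_eq_mul, mul_comm]

/-- **Light cones.** The number of variables joined to `w` by a co-occurrence walk of length `t`
(steps may stutter) is at most `(k D + 1)^t`, `D` the maximum clause-degree. -/
theorem shwRad_card_ball_le (Φ : Fin m → Fin k → Fin n × Bool) (w : Fin n) (t : ℕ) :
    ((univ : Finset (Fin n)).filter fun v => ∃ p : ℕ → Fin n, p 0 = v ∧ p t = w ∧
        ∀ s, s < t → (p s = p (s + 1) ∨
          ∃ i : Fin m, ∃ j j' : Fin k, (Φ i j).1 = p s ∧ (Φ i j').1 = p (s + 1))).card ≤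
      (k * ((univ : Finset (Fin n)).sup fun v =>
          ((univ : Finset (Fin m)).filter fun i => ∃ j, (Φ i j).1 = v).card) + 1) ^ t := by
  set D : ℕ := (univ : Finset (Fin n)).sup fun v =>
      ((univ : Finset (Fin m)).filter fun i => ∃ j, (Φ i j).1 = v).card with hD
  induction t with
  | zero =>
    have heq : ((univ : Finset (Fin n)).filter fun v => ∃ p : ℕ → Fin n, p 0 = v ∧ p 0 = w ∧
        ∀ s, s < 0 → (p s = p (s + 1) ∨
          ∃ i : Fin m, ∃ j j' : Fin k, (Φ i j).1 = p s ∧ (Φ i j').1 = p (s + 1))) = {w} := by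
      ext v
      simp only [mem_filter, mem_univ, true_and, mem_singleton, Nat.not_lt_zero, false_implies,
        implies_true, and_true]
      constructor
      · rintro ⟨p, h0, h0'⟩
        rw [← h0, h0']
      · rintro rfl
        exact ⟨fun _ => v, rfl, rfl⟩
    rw [heq, card_singleton, pow_zero]
  | succ t ih =>
    -- decompose a walk at its first step
    have hsub : ((univ : Finset (Fin n)).filter fun v => ∃ p : ℕ → Fin n, p 0 = v ∧ p (t + 1) = w ∧
        ∀ s, s < t + 1 → (p s = p (s + 1) ∨
          ∃ i : Fin m, ∃ j j' : Fin k, (Φ i j).1 = p s ∧ (Φ i j').1 = p (s + 1))) ⊆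
        ((univ : Finset (Fin n)).filter fun u => ∃ p : ℕ → Fin n, p 0 = u ∧ p t = w ∧
          ∀ s, s < t → (p s = p (s + 1) ∨
            ∃ i : Fin m, ∃ j j' : Fin k, (Φ i j).1 = p s ∧ (Φ i j').1 = p (s + 1))).biUnion
          fun u => insert u ((univ : Finset (Fin n)).filter fun v =>
            ∃ i : Fin m, ∃ j j' : Fin k, (Φ i j).1 = v ∧ (Φ i j').1 = u) := by
      intro v hv
      simp only [mem_filter, mem_univ, true_and] at hv
      obtain ⟨p, h0, hlast, hstep⟩ := hv
      rw [Finset.mem_biUnion]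
      refine ⟨p 1, ?_, ?_⟩
      · simp only [mem_filter, mem_univ, true_and]
        refine ⟨fun s => p (s + 1), rfl, hlast, fun s hs => ?_⟩
        exact hstep (s + 1) (by omega)
      · rw [Finset.mem_insert]
        rcases hstep 0 (by omega) with h | ⟨i, j, j', hj, hj'⟩
        · left
          rw [← h0, h]
        · right
          simp only [mem_filter, mem_univ, true_and]
          exact ⟨i, j, j', by rw [hj, h0], hj'⟩
    refine (card_le_card hsub).trans (card_biUnion_le.trans ?_)
    have hu : ∀ u : Fin n, (insert u ((univ : Finset (Fin n)).filter fun v =>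
        ∃ i : Fin m, ∃ j j' : Fin k, (Φ i j).1 = v ∧ (Φ i j').1 = u)).card ≤ k * D + 1 := by
      intro u
      refine (card_insert_le _ _).trans ?_
      have h1 := shwRad_card_cooccur_le Φ u
      have h2 : ((univ : Finset (Fin m)).filter fun i => ∃ j, (Φ i j).1 = u).card ≤ D :=
        Finset.le_sup (f := fun v => ((univ : Finset (Fin m)).filter
          fun i => ∃ j, (Φ i j).1 = v).card) (mem_univ u)
      have := Nat.mul_le_mul_left k h2
      omega
    calc ∑ u ∈ ((univ : Finset (Fin n)).filter fun u => ∃ p : ℕ → Fin n, p 0 = u ∧ p t = w ∧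
            ∀ s, s < t → (p s = p (s + 1) ∨
              ∃ i : Fin m, ∃ j j' : Fin k, (Φ i j).1 = p s ∧ (Φ i j').1 = p (s + 1))),
          (insert u ((univ : Finset (Fin n)).filter fun v =>
            ∃ i : Fin m, ∃ j j' : Fin k, (Φ i j).1 = v ∧ (Φ i j').1 = u)).card
        ≤ ∑ _u ∈ ((univ : Finset (Fin n)).filter fun u => ∃ p : ℕ → Fin n, p 0 = u ∧ p t = w ∧
            ∀ s, s < t → (p s = p (s + 1) ∨
              ∃ i : Fin m, ∃ j j' : Fin k, (Φ i j).1 = p s ∧ (Φ i j').1 = p (s + 1))),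
            (k * D + 1) := sum_le_sum fun u _ => hu u
      _ ≤ (k * D + 1) ^ t * (k * D + 1) := by
          rw [sum_const, smul_eq_mul]
          exact Nat.mul_le_mul_right _ ih
      _ = (k * D + 1) ^ (t + 1) := by rw [pow_succ]

/-- At most `k (kD + 1)^r` variables see a given clause `a` within radius `r` (are joined to one of
its variables by a co-occurrence walk of length `r`). -/
theorem shwRad_card_sees_le (Φ : Fin m → Fin k → Fin n × Bool) (a : Fin m) (r : ℕ) :
    ((univ : Finset (Fin n)).filter fun v => ∃ j : Fin k, ∃ p : ℕ → Fin n, p 0 = v ∧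
        p r = (Φ a j).1 ∧ ∀ s, s < r → (p s = p (s + 1) ∨
          ∃ i : Fin m, ∃ j j' : Fin k, (Φ i j).1 = p s ∧ (Φ i j').1 = p (s + 1))).card ≤
      k * (k * ((univ : Finset (Fin n)).sup fun v =>
          ((univ : Finset (Fin m)).filter fun i => ∃ j, (Φ i j).1 = v).card) + 1) ^ r := by
  have hsub : ((univ : Finset (Fin n)).filter fun v => ∃ j : Fin k, ∃ p : ℕ → Fin n, p 0 = v ∧
        p r = (Φ a j).1 ∧ ∀ s, s < r → (p s = p (s + 1) ∨
          ∃ i : Fin m, ∃ j j' : Fin k, (Φ i j).1 = p s ∧ (Φ i j').1 = p (s + 1))) ⊆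
      (univ : Finset (Fin k)).biUnion fun j => (univ : Finset (Fin n)).filter fun v =>
        ∃ p : ℕ → Fin n, p 0 = v ∧ p r = (Φ a j).1 ∧ ∀ s, s < r → (p s = p (s + 1) ∨
          ∃ i : Fin m, ∃ j j' : Fin k, (Φ i j).1 = p s ∧ (Φ i j').1 = p (s + 1)) := by
    intro v hv
    simp only [mem_filter, mem_univ, true_and] at hv
    obtain ⟨j, hj⟩ := hv
    rw [Finset.mem_biUnion]
    refine ⟨j, mem_univ _, ?_⟩
    simp only [mem_filter, mem_univ, true_and]
    exact hj
  refine (card_le_card hsub).trans (card_biUnion_le.trans ?_)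
  calc ∑ j : Fin k, ((univ : Finset (Fin n)).filter fun v =>
          ∃ p : ℕ → Fin n, p 0 = v ∧ p r = (Φ a j).1 ∧ ∀ s, s < r → (p s = p (s + 1) ∨
            ∃ i : Fin m, ∃ j j' : Fin k, (Φ i j).1 = p s ∧ (Φ i j').1 = p (s + 1))).card
      ≤ ∑ _j : Fin k, (k * ((univ : Finset (Fin n)).sup fun v =>
          ((univ : Finset (Fin m)).filter fun i => ∃ j, (Φ i j).1 = v).card) + 1) ^ r :=
        sum_le_sum fun j _ => shwRad_card_ball_le Φ (Φ a j).1 r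
    _ = _ := by rw [sum_const, card_univ, Fintype.card_fin, smul_eq_mul]

end RadiusLocal

section RadiusHamming

variable {m k n : ℕ} {r : ℕ}

/-- **Locality ⇒ bounded differences.** For a radius-`r` local rule `g` (hypothesis `hloc`: the
output bit at `v` is any label-dependent function of the labelled clauses that `v` sees within
radius `r`) and two instances that agree off clause `a`, the outputs differ only at variables that
see clause `a` within radius `r` in one of the two instances. -/
theorem shwRad_hamming_le (g : (Fin m → Fin k → Fin n × Bool) → (Fin n → Bool))
    (hloc : ∀ (Φ Φ' : Fin m → Fin k → Fin n × Bool) (v : Fin n),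
      (∀ i : Fin m,
        ((∃ j : Fin k, ∃ p : ℕ → Fin n, p 0 = v ∧ p r = (Φ i j).1 ∧ ∀ s, s < r → (p s = p (s + 1) ∨
            ∃ i' : Fin m, ∃ j₁ j₂ : Fin k, (Φ i' j₁).1 = p s ∧ (Φ i' j₂).1 = p (s + 1))) ∨
         (∃ j : Fin k, ∃ p : ℕ → Fin n, p 0 = v ∧ p r = (Φ' i j).1 ∧ ∀ s, s < r → (p s = p (s + 1) ∨
            ∃ i' : Fin m, ∃ j₁ j₂ : Fin k, (Φ' i' j₁).1 = p s ∧ (Φ' i' j₂).1 = p (s + 1)))) →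
        Φ i = Φ' i) →
      g Φ v = g Φ' v)
    (Φ Φ' : Fin m → Fin k → Fin n × Bool) (a : Fin m) (hoff : ∀ i, i ≠ a → Φ i = Φ' i) :
    hammingDist (g Φ) (g Φ') ≤
      ((univ : Finset (Fin n)).filter fun v => ∃ j : Fin k, ∃ p : ℕ → Fin n, p 0 = v ∧
        p r = (Φ a j).1 ∧ ∀ s, s < r → (p s = p (s + 1) ∨
          ∃ i' : Fin m, ∃ j₁ j₂ : Fin k, (Φ i' j₁).1 = p s ∧ (Φ i' j₂).1 = p (s + 1))).card +
      ((univ : Finset (Fin n)).filter fun v => ∃ j : Fin k, ∃ p : ℕ → Fin n, p 0 = v ∧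
        p r = (Φ' a j).1 ∧ ∀ s, s < r → (p s = p (s + 1) ∨
          ∃ i' : Fin m, ∃ j₁ j₂ : Fin k, (Φ' i' j₁).1 = p s ∧ (Φ' i' j₂).1 = p (s + 1))).card := by
  set S : Finset (Fin n) := ((univ : Finset (Fin n)).filter fun v => ∃ j : Fin k, ∃ p : ℕ → Fin n, p 0 = v ∧
        p r = (Φ a j).1 ∧ ∀ s, s < r → (p s = p (s + 1) ∨
          ∃ i' : Fin m, ∃ j₁ j₂ : Fin k, (Φ i' j₁).1 = p s ∧ (Φ i' j₂).1 = p (s + 1))) with hS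
  set S' : Finset (Fin n) := ((univ : Finset (Fin n)).filter fun v => ∃ j : Fin k, ∃ p : ℕ → Fin n, p 0 = v ∧
        p r = (Φ' a j).1 ∧ ∀ s, s < r → (p s = p (s + 1) ∨
          ∃ i' : Fin m, ∃ j₁ j₂ : Fin k, (Φ' i' j₁).1 = p s ∧ (Φ' i' j₂).1 = p (s + 1))) with hS'
  have hsub : ((univ : Finset (Fin n)).filter fun v => g Φ v ≠ g Φ' v) ⊆ S ∪ S' := by
    intro v hv
    simp only [mem_filter, mem_univ, true_and] at hv
    by_contra hnot
    rw [Finset.mem_union, not_or] at hnot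
    apply hv
    apply hloc Φ Φ' v
    intro i hi
    by_cases hia : i = a
    · subst hia
      exfalso
      rcases hi with hi | hi
      · exact hnot.1 (by rw [hS]; exact Finset.mem_filter.2 ⟨mem_univ _, hi⟩)
      · exact hnot.2 (by rw [hS']; exact Finset.mem_filter.2 ⟨mem_univ _, hi⟩)
    · exact hoff i hia
  calc hammingDist (g Φ) (g Φ') = ((univ : Finset (Fin n)).filter fun v => g Φ v ≠ g Φ' v).card := rfl
    _ ≤ (S ∪ S').card := Finset.card_le_card hsub
    _ ≤ S.card + S'.card := Finset.card_union_le _ _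

/-- **Radius-`r` local rules are typically Lipschitz.** Under `hloc`, a single-literal change moves
the output by at most `2k (kD + k + 1)^r` in Hamming distance (`D` the maximum clause-degree of the
instance before the change; after it the maximum clause-degree is `≤ D + 1`). -/
theorem shwRad_hamming_update_le (g : (Fin m → Fin k → Fin n × Bool) → (Fin n → Bool))
    (hloc : ∀ (Φ Φ' : Fin m → Fin k → Fin n × Bool) (v : Fin n),
      (∀ i : Fin m,
        ((∃ j : Fin k, ∃ p : ℕ → Fin n, p 0 = v ∧ p r = (Φ i j).1 ∧ ∀ s, s < r → (p s = p (s + 1) ∨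
            ∃ i' : Fin m, ∃ j₁ j₂ : Fin k, (Φ i' j₁).1 = p s ∧ (Φ i' j₂).1 = p (s + 1))) ∨
         (∃ j : Fin k, ∃ p : ℕ → Fin n, p 0 = v ∧ p r = (Φ' i j).1 ∧ ∀ s, s < r → (p s = p (s + 1) ∨
            ∃ i' : Fin m, ∃ j₁ j₂ : Fin k, (Φ' i' j₁).1 = p s ∧ (Φ' i' j₂).1 = p (s + 1)))) →
        Φ i = Φ' i) →
      g Φ v = g Φ' v)
    (Φ : Fin m → Fin k → Fin n × Bool) (a : Fin m) (b : Fin k) (ℓ : Fin n × Bool) :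
    (hammingDist (g Φ) (g (Function.update Φ a (Function.update (Φ a) b ℓ))) : ℝ)
      ≤ 2 * k * (k * (((univ : Finset (Fin n)).sup fun v =>
          ((univ : Finset (Fin m)).filter fun i => ∃ j, (Φ i j).1 = v).card) : ℕ) + k + 1) ^ r := by
  set Φ' := Function.update Φ a (Function.update (Φ a) b ℓ) with hΦ'
  set D : ℕ := ((univ : Finset (Fin n)).sup fun v =>
          ((univ : Finset (Fin m)).filter fun i => ∃ j, (Φ i j).1 = v).card) with hD
  set D' : ℕ := ((univ : Finset (Fin n)).sup fun v =>
          ((univ : Finset (Fin m)).filter fun i => ∃ j, (Φ' i j).1 = v).card) with hD'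
  have hoff : ∀ i, i ≠ a → Φ i = Φ' i := fun i hi => by rw [hΦ', Function.update_of_ne hi]
  have h1 := shwRad_hamming_le g hloc Φ Φ' a hoff
  have h2 := shwRad_card_sees_le Φ a r
  have h3 := shwRad_card_sees_le Φ' a r
  have hDD : D' ≤ D + 1 := by
    rw [hD', hD, hΦ']
    exact sissT_maxdeg_update_le Φ a (Function.update (Φ a) b ℓ)
  have hnat : hammingDist (g Φ) (g Φ') ≤ k * (k * D + 1) ^ r + k * (k * (D + 1) + 1) ^ r := by
    calc hammingDist (g Φ) (g Φ') ≤ _ := h1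
      _ ≤ k * (k * D + 1) ^ r + k * (k * D' + 1) ^ r := Nat.add_le_add h2 h3
      _ ≤ k * (k * D + 1) ^ r + k * (k * (D + 1) + 1) ^ r := by
          have hb : k * D' + 1 ≤ k * (D + 1) + 1 := by
            have := Nat.mul_le_mul_left k hDD
            omega
          exact Nat.add_le_add_left (Nat.mul_le_mul_left k (Nat.pow_le_pow_left hb r)) _
  have hR : ((hammingDist (g Φ) (g Φ') : ℕ) : ℝ) ≤
      ((k * (k * D + 1) ^ r + k * (k * (D + 1) + 1) ^ r : ℕ) : ℝ) := by
    exact_mod_cast hnat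
  refine hR.trans ?_
  push_cast
  have hk0 : (0 : ℝ) ≤ k := Nat.cast_nonneg _
  have hD0 : (0 : ℝ) ≤ D := Nat.cast_nonneg _
  have hp1 : ((k : ℝ) * D + 1) ^ r ≤ (k * D + k + 1) ^ r :=
    pow_le_pow_left₀ (by positivity) (by linarith) r
  have hp2 : ((k : ℝ) * (D + 1) + 1) ^ r = (k * D + k + 1) ^ r := by ring
  rw [hp2]
  nlinarith [mul_le_mul_of_nonneg_left hp1 hk0]

/-- **Radius-`r` local rules are ℓ²-stable.** If `1 ≤ n`, `m ≤ αn` and `e^{αke²} ≤ n³`, a radius-`r`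
local map `g` has
`∑_{(a,b)} ∑_{(Φ,ℓ)} d_H(g Φ, g Φ[(a,b) ↦ ℓ])² ≤ ((2k(3k log n + k + 1)^r)² + 1)·(m k)·#Inst·2n`. -/
theorem shwRad_meanSquare (hn : 1 ≤ n) (α : ℝ) (hα : 0 ≤ α) (hm : (m : ℝ) ≤ α * n)
    (hlarge : Real.exp (α * k * Real.exp 2) ≤ (n : ℝ) ^ 3)
    (g : (Fin m → Fin k → Fin n × Bool) → (Fin n → Bool))
    (hloc : ∀ (Φ Φ' : Fin m → Fin k → Fin n × Bool) (v : Fin n),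
      (∀ i : Fin m,
        ((∃ j : Fin k, ∃ p : ℕ → Fin n, p 0 = v ∧ p r = (Φ i j).1 ∧ ∀ s, s < r → (p s = p (s + 1) ∨
            ∃ i' : Fin m, ∃ j₁ j₂ : Fin k, (Φ i' j₁).1 = p s ∧ (Φ i' j₂).1 = p (s + 1))) ∨
         (∃ j : Fin k, ∃ p : ℕ → Fin n, p 0 = v ∧ p r = (Φ' i j).1 ∧ ∀ s, s < r → (p s = p (s + 1) ∨
            ∃ i' : Fin m, ∃ j₁ j₂ : Fin k, (Φ' i' j₁).1 = p s ∧ (Φ' i' j₂).1 = p (s + 1)))) →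
        Φ i = Φ' i) →
      g Φ v = g Φ' v) :
    (∑ a : Fin m, ∑ b : Fin k, ∑ p : (Fin m → Fin k → Fin n × Bool) × (Fin n × Bool),
        (hammingDist (g p.1) (g (Function.update p.1 a (Function.update (p.1 a) b p.2))) : ℝ) ^ 2)
      ≤ ((2 * k * (3 * k * Real.log n + k + 1) ^ r) ^ 2 + 1)
          * (((m * k : ℕ) : ℝ) * (Fintype.card (Fin m → Fin k → Fin n × Bool) * (2 * n))) := by
  refine shwLoc_meanSquare_of_typLipschitz hn α hα hm hlarge g
    (2 * k * (3 * k * Real.log n + k + 1) ^ r) ?_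
  intro Φ hΦ a b ℓ
  have h := shwRad_hamming_update_le (r := r) g hloc Φ a b ℓ
  have hk0 : (0 : ℝ) ≤ k := Nat.cast_nonneg _
  have hD0 : (0 : ℝ) ≤ ((((univ : Finset (Fin n)).sup fun v =>
          ((univ : Finset (Fin m)).filter fun i => ∃ j, (Φ i j).1 = v).card) : ℕ) : ℝ) := Nat.cast_nonneg _
  have hmono : ((k : ℝ) * ((((univ : Finset (Fin n)).sup fun v =>
          ((univ : Finset (Fin m)).filter fun i => ∃ j, (Φ i j).1 = v).card) : ℕ) : ℝ) + k + 1) ^ r ≤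
      (3 * k * Real.log n + k + 1) ^ r := by
    apply pow_le_pow_left₀ (by positivity)
    nlinarith [mul_le_mul_of_nonneg_left hΦ hk0]
  have h2k : (0 : ℝ) ≤ 2 * k := by positivity
  linarith only [h, mul_le_mul_of_nonneg_left hmono h2k]

end RadiusHamming

end Summit.PneNP.PneNP.Theorems
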